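import Summits.RiemannHypothesis.RiemannHypothesis.Theses.RuelleBand
import Summits.RiemannHypothesis.RiemannHypothesis.Theorems.RuelleBandCofiniteCriticalLineStubWindowIndexFinite
import Summits.RiemannHypothesis.RiemannHypothesis.Theorems.RuelleBandCofiniteCriticalLineStubCofiniteWeilCriterion
import Summits.RiemannHypothesis.RiemannHypothesis.Theorems.RuelleBandCofiniteCriticalLineStubZeroLevelNullVector
import Summits.RiemannHypothesis.RiemannHypothesis.Theorems.RuelleBandCofiniteCriticalLineStubDefinitize
import Summits.RiemannHypothesis.RiemannHypothesis.Theorems.RuelleBandCofiniteCriticalLineStubZeroLevelWindow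
import Summits.RiemannHypothesis.RiemannHypothesis.Theorems.RuelleBandCofiniteCriticalLineStubCalibrationENDOfRH
import Summits.RiemannHypothesis.RiemannHypothesis.Theorems.RuelleBandCofiniteCriticalLineStubCalibrationENDOfCofinite
import Summits.RiemannHypothesis.RiemannHypothesis.Theorems.RuelleBandCofiniteCriticalLineStubEntireEqZeroOfLevinson
import Literature.Analysis.OperatorTheory.KreinLangerDefinitizationProofs
import HarnessLib.Audit

/-!
# Line `cofinite-weil-index-staircase` — skeleton for crux `RuelleBand.CofiniteCriticalLine`
(item stmt-RiemannHypothesis-2064, route route-RiemannHypothesis-RuelleBand; crux-plan, round 1)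

Crux (FIXED, route decl): `CofiniteCriticalLine : {s | ζ s = 0 ∧ 0 < re s < 1 ∧ re s ≠ 1/2}.Finite`
("all but finitely many non-trivial zeros lie on the critical line").

Idea (crux idea `Cruxes/CofiniteCriticalLine/Ideas/cofinite-weil-index-staircase.md`, triage r1 k1–k3:
pass; merged reading "one Weil-INDEX line, bet = eventual non-degeneracy"): the negative index
`n₋(a)` of Weil's quadratic form `Q(g) = W(g ⋆ g̃)` (`weilQuadratic`) restricted to test functions on
the window `[-a, a]` is finite for every window (Yoshida 1992; Connes–Consani–Moscovici 2025 Thm 3.6,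
PROVED in tree as `ConnesConsaniMoscovici2025_thm_3_6_holds`), non-decreasing in `a`, and can step up
between two windows only across a CONJUGATE WINDOW `a*` at which the closed window form has a
non-zero null vector (a zero min–max level; Morse–Kneser shape).  If no conjugate window occurs
beyond some `a₀` (the BET, `stub_eventuallyNondegenerate`, typed on the FORM DOMAIN as the triage
asked), the staircase is bounded; a uniformly bounded index makes every translation kernel
`x ↦ Q(f_x, f)` a function with `≤ N` negative squares, hence DEFINITIZABLE by a polynomial
differential operator of degree `≤ N` (Pontryagin 1944 / Kreĭn–Langer 1977 / Sasvári 1994,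
`stub_definitize`); and Weil positivity on the translation orbit of ONE test function `p(-D) f`
already forces `m(ρ) · p(ρ-½) conj p(½-ρ̄) · f̂(ρ) conj f̂(1-ρ̄) = 0` at every off-line zero (the
Laplace-transform / identity-theorem proof of `WeilConverse.order_mul_pairCoeff_eq_zero` runs inside
the orbit), so all off-line zeros seen by `f` sit among the `≤ 2D` points `½ + roots p`,
`½ - conj roots p`; a generic narrow bump sees any prescribed finite set of zeros — this is the
COFINITE WEIL CRITERION of the card (`stub_cofiniteWeilCriterion`, concluding the finiteness of the
off-line zero set verbatim), and `CofiniteCriticalLine_of` concludes the crux BY NAME.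

STATUS (continuation lead c2, 2026-08-16 18:30Z).  The bet is now CERTIFIED crux-equivalent: `crux ⟹ END` is LANDED
UNCONDITIONALLY as `NS.stub_calibration_END_of_cofinite_unconditional : CofiniteCriticalLine → END` (registered form
`NS.stub_calibration_END_of_cofinite : Anderson1983_levinson_simple → crux → END` ignores its first hypothesis; helper stubs C1
`stub_polarZeroForm` p115967, C2 `stub_expPolyDominates` p116234, C3 `stub_entire_eq_zero_of_levinson` p116024, C4
`stub_distinctZeroCount_ge_selberg` p118034 (Selberg's theorem for DISTINCT zeros, unconditional), C5
`stub_entire_eq_zero_of_distinct_density` p117525; Aux p116877), and `NS.END_iff_cofiniteCriticalLine` /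
`NS.END_iff_boundedWeilIndex` (`Theorems/RuelleBandCofiniteCriticalLineENDIff.lean`) assemble END ⟺ crux ⟺ BoundedWeilIndex modulo
branch continuity ONLY (p84125, un-co-importable).  So the line is an exact REFORMULATION of rung #5 with no stub weaker than the crux;
sorries left below: `stub_eventuallyNondegenerate` (= the crux) and `stub_branchesContinuous` (proved, un-importable).
Earlier status (c1, 14:00Z):   Of the seven registered stubs of lead 0's reshape, FOUR are LANDED
unconditionally and are IMPORTED and used by name from `Summit.RiemannHypothesis.RiemannHypothesis.Theorems.RuelleBandCofiniteCriticalLine`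
(NS): `NS.stub_windowIndexFinite` (p78224), `NS.stub_cofiniteWeilCriterion` (p82910), `NS.stub_zeroLevelNullVector` (p95592, + Aux…Aux5),
`NS.stub_zeroLevelWindow` (p95831, + Aux p95769); `NS.stub_branchesContinuous` (p84125, + Aux, Aux2) is LANDED but CANNOT be imported into
this file: its module imports `WeilWindowSuzukiContinuityProofs` (for `exists_weilDilate_modulus`), whose import closure declares
`Literature.NumberTheory.LFunctions.WeilWindowSimpleEven` in `WeilGroundStateRealZeros.lean:96`, while the `…StubZeroLevelNullVector*`
modules import `WeilWindowSimpleEven.lean`, which declares the SAME name at line 87 (definitionally identical duplicate `def`;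
"environment already contains …WeilWindowSimpleEven").  This TREE DEFECT needs a librarian/operator restructure (any prover-side
whole-file fix bounces `lint.removes-referenced-decl`; moving the dilation modulus out of the Suzuki chain is a two-file migration);
it is filed as audit `audit:p43005` on `WeilGroundStateRealZeros.lean` (fix: import `WeilWindowSimpleEven`, drop lines 87–100).  Until
then `stub_branchesContinuous` stays below as a `sorry` whose proof EXISTS in the tree with this exact signature.
`stub_kreinDefinitization` (Kreĭn 1959 / Stewart 1972 definitization; the named Literature fact
`Literature.Analysis.OperatorTheory.KreinDefinitization`, p83087) is now PROVED IN THE TREE: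
`Literature.Analysis.OperatorTheory.KreinDefinitization_holds` (`Literature/Analysis/OperatorTheory/KreinLangerDefinitizationProofs.lean`
with `KreinStewart{Defs,NegSquares,FiniteDim,Compression,Abstract,TranslationForm}.lean`: degenerate-tolerant finite-dimensional
Pontryagin lemma, compression of the symmetric difference-quotient operators `(τ_h − τ_{−h})/(2ih)` on point masses to saturated
finite-dimensional hulls, compactness on the coefficient sphere and over configurations, `h → 0⁺`) — so Stub 5′ and Stub 5
(`NS.stub_definitize_of_krein`, p84384) are CLOSED, and the shared rung is UNCONDITIONAL:
`NS.boundedWeilIndex_iff_cofiniteCriticalLine : BoundedWeilIndex ↔ CofiniteCriticalLine` (c1 lead, file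
`Theorems/RuelleBandCofiniteCriticalLineBoundedIndexIff.lean`; from p101979 + p104589 + `KreinDefinitization_holds`).
REMAINING OBLIGATIONS: the bet `stub_eventuallyNondegenerate` ONLY (modulo the import repair).  Its strength is now pinned on
paper from both sides: END ⟹ crux (this composition) and crux ⟹ END (drefute report: END ⟺ crux ∧ NoZeroPlateau; cdisprove
c3 §9: crux ⟹ NoZeroPlateau by Weinstein–Aronszajn for the finite-rank off-line part + unbounded off-line pairing of one
translated bump), i.e. END ⟺ crux ⟺ BoundedWeilIndex: the line is an exact operator-side REFORMULATION of rung #5, with no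
stub left that is weaker than the crux.

Dictionary (all VERBATIM expansions, no local `def`, so that every stub lands as a pure theorem over
existing declarations; `Q = weilQuadratic`, `W = weilFunctional`, tests = `IsWeilTest`):
* `WindowIndexLE a N`   ↦ `∀ g : Fin (N+1) → ℝ → ℂ, (∀ i, IsWeilTest (g i)) → (∀ i, tsupport (g i) ⊆ Icc (-a) a) →
                           ∃ c ≠ 0, 0 ≤ Re Q(∑ i, c i * g i)`  (= `SketchIdeator2.WeilIndexOnLE`; `N = 0` is
                           `WeilPositivityOn a`; antitone in `a` by restriction — proved inline below);
* `HasWeilNullVector a` ↦ `∃ u g, u ∈ L², ¬ u =ᵐ 0, gₙ window tests, ∫‖gₙ - u‖² → 0,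
                           Re Q(gₙ - gₘ) → 0 (form-Cauchy), ∀ window tests h, W(gₙ ⋆ h̃) → 0`
                           (a non-zero vector of the FORM DOMAIN of the closed window form with
                           `Q̄(u, h) = 0` on the form core: `0 ∈ σ_p(A_a)` for the Friedrichs/CCM operator;
                           junk-free: for `a < 0` the window is empty and the predicate is false);
* `level a k`           ↦ `sInf {x | ∃ g : Fin (k+1) → tests on the window, LinearIndependent ℂ g ∧
                           x = sSup {Re Q(∑ cᵢgᵢ) : ∫‖∑ cᵢgᵢ‖² = 1}}`  (Courant–Fischer level `μ_k(A_a)`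
                           over the core; `level a 0 = weilGroundEnergy a` for `a > 0`);
* `OrbitPositive D`     ↦ `∀ f test, ∃ p : Polynomial ℂ, p ≠ 0, natDegree p ≤ D, ∀ n x c,
                           0 ≤ Re Q(t ↦ ∑ k, c k * (p(-D) f)(t - x k))`,
                           `p(-D) f := ∑ j ≤ natDegree p, coeff p j * (-1)^j * iteratedDeriv j f`,
                           so that `(p(-D) f)^(s) = p(s - ½) f̂(s)` (`weilMellin_deriv`).

Registered stubs (7 after lead 0's reshape of 2026-08-16; after the c1 pass the sorries left are
`stub_eventuallyNondegenerate` (BET) and `stub_branchesContinuous` (landed, un-importable); `stub_kreinDefinitization` is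
discharged by `KreinDefinitization_holds`, the calibration `stub_calibration_END_of_RH` is LANDED, p99487) and composition:
`stub_eventuallyNondegenerate` (BET) → `stub_branchesContinuous` → (`stub_zeroLevelWindow` →
`stub_zeroLevelNullVector`, glued by the proved `conjugateWindow_of_stubs`) →
`stub_windowIndexFinite` → `stub_definitize` → `stub_cofiniteWeilCriterion`; the closed theorem
`CofiniteCriticalLine_of : RuelleBand.CofiniteCriticalLine` uses them BY NAME (kernel-checked: `a₁ := max a₀ 1`, `N := n₋`-bound at `a₁`; windows
`a ≤ a₁` by restriction, windows `a > a₁` by the conjugate-window lemma against the bet).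

Disproof.lean (cdisprove cycle 1, v4) honoured: `cofiniteCriticalLine_false_without_neHalf` (Hardy) —
the line kills only OFF-line coefficients (`Re (ρ - ½) ≠ 0` in the fibre lemma
`BoundedPowerSum.sum_fiber_eq_zero_of_exp_real`, used at `stub_cofiniteWeilCriterion`); on-line zeros
contribute `m(ρ)|ĝ(ρ)|² ≥ 0` and are never counted; `…_false_without_rePos/zeta`: the zero side runs
over `riemannZetaNontrivialZeros` only.  Landed Negative lemmas (`Theorems/CofiniteCriticalLine/Negative/`,
read; their modules were unbuilt on the farm at check time, so they are not imported) checked against: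
`Negative.not_abstract_asymptotic_imp_cofinite` (no stub derives rung #5 from rung #4's shape; the
arithmetic enters through the explicit formula with its prime term and through the bet),
`Negative.not_cofinite_shape_davenportHeilbronn` (for Davenport–Heilbronn the window index is still
finite but the staircase is unbounded: the bet is where the Euler product is load-bearing).
No `_false_without_<H>` theorem about a hypothesis H of a transfer exists (the crux has no hypotheses);
RH ⇒ every stub's statement (bet included: under RH `level a 0 = ε(a) > 0` for all `a > 0`).
-/

set_option linter.dupNamespace false

noncomputable section

open Complex MeasureTheory Filter Set
open scoped BigOperators Topology ComplexConjugate

namespace Summit.RiemannHypothesis.RiemannHypothesis.Cruxes.CofiniteCriticalLine.CofiniteWeilIndexStaircase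

open Literature.NumberTheory.LFunctions

/-! ### The registered stubs (signatures over existing declarations only) -/

/-- **Stub 1 — THE BET `C⁺` (eventual non-degeneracy, "no late conjugate window"; RH-implied,
crux-strength).**  There is `a₀` such that for every window `a ≥ a₀` the closed Weil form on `[-a, a]`
has NO non-zero null vector in its form domain: no `u ∈ L²`, `u ≠ 0`, which is an `L²`- and
form-Cauchy limit of window test functions `gₙ` with `W(gₙ ⋆ h̃) → 0` for every window test `h`
(i.e. `0 ∉ σ_p(A_a)`, `A_a` the lower-bounded self-adjoint operator of CCM25 (3.23) / the Friedrichs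
extension of Suzuki 2026 Thm 1.1; equivalently no `L²` null vector of Bombieri's truncated operator
`L_a`, Bombieri 2000 (4.2), alternative (iii) of Thms 10–11 with eigenvalue EXACTLY `0`).
Under RH it holds for every `a > 0` (`Q̄(u) = Σ m(ρ)|û(ρ)|² > 0`, `û` entire of exponential type).
Research content: unique continuation for ONE explicit delay–integral operator per window
(finitely many prime delays `log n ≤ 2a`, log-kinetic archimedean part, rank-2 polar part);
`a₀` may be ineffective. -/
theorem stub_eventuallyNondegenerate :
    ∃ a₀ : ℝ, ∀ a : ℝ, a₀ ≤ a →
      ¬ ∃ (u : ℝ → ℂ) (g : ℕ → ℝ → ℂ), MemLp u 2 volume ∧ ¬ (u =ᵐ[volume] 0) ∧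
          (∀ n, IsWeilTest (g n) ∧ tsupport (g n) ⊆ Set.Icc (-a) a) ∧
          Tendsto (fun n => ∫ t, ‖g n t - u t‖ ^ 2) atTop (𝓝 0) ∧
          Tendsto (fun q : ℕ × ℕ => (weilQuadratic (g q.1 - g q.2)).re) atTop (𝓝 0) ∧
          ∀ h : ℝ → ℂ, IsWeilTest h → tsupport h ⊆ Set.Icc (-a) a →
            Tendsto (fun n => weilFunctional (weilConv (g n) (weilReflect h))) atTop (𝓝 0) := by
  sorry

/-- **Calibration — the bet is RH-implied AS TYPED — LANDED** (p99487, helpers Aux p97652, Aux2 p97910) as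
`Summit.RiemannHypothesis.RiemannHypothesis.Theorems.RuelleBandCofiniteCriticalLine.stub_calibration_END_of_RH`
(documentation; not used by the composition).  Under RH, `Q ≥ 0` (`WeilPositivity.of_riemannHypothesis`); a null vector `u`
with its `L²`- and form-Cauchy approximants `gₙ` has `Q(gₙ) → 0`, hence by the explicit formula `û(ρ) = lim ĝₙ(ρ) = 0` at EVERY
non-trivial zero; `û` is entire of exponential type `≤ a`, and Jensen's count against the `≫ T log T` zeta zeros forces `û ≡ 0`,
so `u = 0` a.e. (Plancherel) — contradiction.  Hence END holds under RH for EVERY window `a > 0`; re-exported by name. [folklore] -/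
theorem stub_calibration_END_of_RH_holds : RiemannHypothesis →
    ∀ a : ℝ, 0 < a →
      ¬ ∃ (u : ℝ → ℂ) (g : ℕ → ℝ → ℂ), MemLp u 2 volume ∧ ¬ (u =ᵐ[volume] 0) ∧
          (∀ n, IsWeilTest (g n) ∧ tsupport (g n) ⊆ Set.Icc (-a) a) ∧
          Tendsto (fun n => ∫ t, ‖g n t - u t‖ ^ 2) atTop (𝓝 0) ∧
          Tendsto (fun q : ℕ × ℕ => (weilQuadratic (g q.1 - g q.2)).re) atTop (𝓝 0) ∧
          ∀ h : ℝ → ℂ, IsWeilTest h → tsupport h ⊆ Set.Icc (-a) a →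
            Tendsto (fun n => weilFunctional (weilConv (g n) (weilReflect h))) atTop (𝓝 0) :=
  Summit.RiemannHypothesis.RiemannHypothesis.Theorems.RuelleBandCofiniteCriticalLine.stub_calibration_END_of_RH

/-- RH ⇒ the bet (from the calibration stub, with `a₀ := 1`). [folklore] -/
theorem stub_eventuallyNondegenerate_of_RH (hRH : RiemannHypothesis) :
    ∃ a₀ : ℝ, ∀ a : ℝ, a₀ ≤ a →
      ¬ ∃ (u : ℝ → ℂ) (g : ℕ → ℝ → ℂ), MemLp u 2 volume ∧ ¬ (u =ᵐ[volume] 0) ∧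
          (∀ n, IsWeilTest (g n) ∧ tsupport (g n) ⊆ Set.Icc (-a) a) ∧
          Tendsto (fun n => ∫ t, ‖g n t - u t‖ ^ 2) atTop (𝓝 0) ∧
          Tendsto (fun q : ℕ × ℕ => (weilQuadratic (g q.1 - g q.2)).re) atTop (𝓝 0) ∧
          ∀ h : ℝ → ℂ, IsWeilTest h → tsupport h ⊆ Set.Icc (-a) a →
            Tendsto (fun n => weilFunctional (weilConv (g n) (weilReflect h))) atTop (𝓝 0) :=
  ⟨1, fun a ha => stub_calibration_END_of_RH_holds hRH a (lt_of_lt_of_le one_pos ha)⟩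

/-! ### Calibration of the bet from BELOW (lead c2, 2026-08-16): `crux ⟹ END`, modulo the unconditional
named fact `Anderson1983_levinson_simple` — three registered helper stubs C1–C3 and the assembly. -/

/-- **Stub C1 — the POLAR zero form.** For test functions `g, h` the Weil number `W(g ⋆ h̃)` is the
absolutely convergent zero sum `Σ_ρ m(ρ) ĝ(ρ) conj ĥ(1 − ρ̄)` over the non-trivial zeros
(`explicit_formula_holds` applied to the test function `g ⋆ h̃`, whose transform is
`ĝ(s) · conj ĥ(1 − s̄)` by `weilMellin_weilConv_holds` / `weilMellin_weilReflect_holds`; absolute convergence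
from `norm_weilMellin_le` at `ρ` and `1 − ρ̄` and `summable_norm_zeroSide_of_le`; identification of the
symmetric limit with the `tsum` by `hasWeilZeroSide_tsum` and uniqueness of limits — the `g = h` case is
`WeilConverse.hasWeilZeroSide_zeroForm` + `stub_cofiniteWeilCriterion_zeroForm_eq`). [folklore] -/
theorem stub_polarZeroForm : ∀ {g h : ℝ → ℂ}, IsWeilTest g → IsWeilTest h →
    (Summable fun ρ : ZetaZeros.riemannZetaNontrivialZeros =>
      ‖(riemannZetaZeroOrder (ρ : ℂ) : ℂ) *
        (weilMellin g ρ * conj (weilMellin h (1 - conj (ρ : ℂ))))‖) ∧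
    weilFunctional (weilConv g (weilReflect h)) =
      ∑' ρ : ZetaZeros.riemannZetaNontrivialZeros,
        (riemannZetaZeroOrder (ρ : ℂ) : ℂ) *
          (weilMellin g ρ * conj (weilMellin h (1 - conj (ρ : ℂ)))) :=
  Summit.RiemannHypothesis.RiemannHypothesis.Theorems.RuelleBandCofiniteCriticalLine.stub_polarZeroForm

/-- **Stub C2 — exponential polynomials dominate every quadratic bound on long intervals.** For finitely
many DISTINCT exponents `λᵢ` off the imaginary axis and non-zero weights `cᵢ`, and any `K`, there is a
length `L` such that no non-zero coefficient vector `w` keeps `|Σᵢ cᵢ wᵢ e^{λᵢ x}|² ≤ K Σᵢ |wᵢ|²` on all of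
`[−L, L]`.  (Pointwise: a bounded exponential polynomial with exponents of non-zero real part vanishes,
`Literature.Analysis.Complex.BoundedPowerSum.sum_fiber_eq_zero_of_exp_real` with singleton fibres; uniformity
in `w` on the compact unit sphere by a finite subcover, then homogeneity.) [folklore] -/
theorem stub_expPolyDominates : ∀ {ι : Type} (s : Finset ι) (lam c : ι → ℂ),
    Set.InjOn lam ↑s → (∀ i ∈ s, (lam i).re ≠ 0) → (∀ i ∈ s, c i ≠ 0) →
    ∀ K : ℝ, ∃ L : ℝ, 0 ≤ L ∧ ∀ w : ι → ℂ,
      (∀ x : ℝ, |x| ≤ L →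
        ‖∑ i ∈ s, c i * w i * cexp (lam i * x)‖ ^ 2 ≤ K * ∑ i ∈ s, ‖w i‖ ^ 2) →
      ∀ i ∈ s, w i = 0 :=
  Summit.RiemannHypothesis.RiemannHypothesis.Theorems.RuelleBandCofiniteCriticalLine.stub_expPolyDominates

/-- **Stub C3 — too many DISTINCT zeros for an entire function of exponential type (Levinson–Anderson
instead of RH).** An entire `f` with `‖f(s)‖ ≤ B e^{A|Re s − 1/2|}` vanishing at every non-trivial zero of
`ζ` is `≡ 0`: Jensen about a point where `f ≠ 0` bounds the distinct zeros of the box `0 < Im ρ ≤ T`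
(which lie in the disc of radius `T + 1 + |s₀ − 1/2|`, no RH needed) by `αT + β`, while
`N_d(T) ≥ N⁽¹⁾(T) ≥ N(T)/3 ≥ (T/6π) log T (1 − o(1))` by `Anderson1983_levinson_simple.third`
(`simpleCriticalZeroCount ≤ distinctZeroCount`) and Riemann–von Mangoldt (`ZeroGapsProofs.eventually_mul_log_le`).
Same proof as the landed `stub_calibration_END_of_RH_entire_eq_zero` with these two substitutions. [folklore] -/
theorem stub_entire_eq_zero_of_levinson : Anderson1983_levinson_simple → ∀ {f : ℂ → ℂ},
    Differentiable ℂ f → ∀ {A B : ℝ}, 0 ≤ A →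
      (∀ s : ℂ, ‖f s‖ ≤ B * Real.exp (A * |s.re - 1 / 2|)) →
        (∀ ρ ∈ ZetaZeros.riemannZetaNontrivialZeros, f ρ = 0) → ∀ s : ℂ, f s = 0 :=
  Summit.RiemannHypothesis.RiemannHypothesis.Theorems.RuelleBandCofiniteCriticalLine.stub_entire_eq_zero_of_levinson

/-- **Stub C4 — Selberg's theorem for DISTINCT zeros — LANDED** (p118034) as `Summit.RiemannHypothesis.RiemannHypothesis.Theorems.RuelleBandCofiniteCriticalLine.stub_distinctZeroCount_ge_selberg`:
UNCONDITIONALLY `N_d(T) ≥ c₁ T log T` for large `T` (Selberg's measure form, PROVED in the tree as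
`SelbergMollifier.selberg_volume_criticalZeros_ge` + the three Titchmarsh lemma `_holds`, run through a distinct-ordinate covering
step).  This replaces Anderson's named fact in the calibration below. [cite: Titchmarsh1986, Theorem 10.22] -/
theorem stub_distinctZeroCount_ge_selberg :
    ∃ c₁ : ℝ, 0 < c₁ ∧ ∃ T₁ : ℝ, ∀ T : ℝ, T₁ ≤ T →
      c₁ * (T * Real.log T) ≤ (Literature.NumberTheory.LFunctions.distinctZeroCount T : ℝ) :=
  Summit.RiemannHypothesis.RiemannHypothesis.Theorems.RuelleBandCofiniteCriticalLine.stub_distinctZeroCount_ge_selberg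

/-- **Stub C5 — too many distinct zeros, density form — LANDED** (p117525) as
`Summit.RiemannHypothesis.RiemannHypothesis.Theorems.RuelleBandCofiniteCriticalLine.stub_entire_eq_zero_of_distinct_density`: an entire function of exponential type in `Re s` vanishing at every
non-trivial zero is `≡ 0`, given a super-linear DISTINCT zero count (Jensen). [folklore] -/
theorem stub_entire_eq_zero_of_distinct_density :
    (∃ c₁ : ℝ, 0 < c₁ ∧ ∃ T₁ : ℝ, ∀ T : ℝ, T₁ ≤ T →
      c₁ * (T * Real.log T) ≤ (distinctZeroCount T : ℝ)) →
    ∀ {f : ℂ → ℂ}, Differentiable ℂ f → ∀ {A B : ℝ}, 0 ≤ A →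
      (∀ s : ℂ, ‖f s‖ ≤ B * Real.exp (A * |s.re - 1 / 2|)) →
        (∀ ρ ∈ ZetaZeros.riemannZetaNontrivialZeros, f ρ = 0) → ∀ s : ℂ, f s = 0 :=
  Summit.RiemannHypothesis.RiemannHypothesis.Theorems.RuelleBandCofiniteCriticalLine.stub_entire_eq_zero_of_distinct_density

/-- **Calibration from below — `crux ⟹ END` (lead c2; modulo `Anderson1983_levinson_simple`).**  Under the
crux let `E` be the finite, reflection-closed set of off-line non-trivial zeros.  For a test `g` the zero side
splits as `Re Q(g) = P(g) + F(g)`, `P(g) = Σ_{ρ ∉ E} m(ρ)|ĝ(ρ)|² ≥ 0`, `F(g) = Re Σ_{ρ ∈ E} m(ρ) ĝ(ρ) conj ĝ(1−ρ̄)`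
(`stub_cofiniteWeilCriterion_zeroForm_eq`; on-line `1 − ρ̄ = ρ`).  A null vector `u` with approximants `gₙ`
has `Re Q(gₙ) → 0` (form-Cauchy and `W(gₙ ⋆ g̃ₘ) → 0`, no positivity needed), `ĝₙ → û` pointwise, hence
`P(gₙ) → −F(û) ≥ 0`, and from `W(gₙ ⋆ h̃) → 0` (Stub C1, Cauchy–Schwarz on the on-line part)
`|Σ_{ρ∈E} m(ρ) û(ρ) conj ĥ(1−ρ̄)|² ≤ (−F(û)) · P(h)` for every window test `h`.  With `h` the translates
`φ(· − x)`, `|x| ≤ a − R`, of ONE bump `φ` (`stub_cofiniteWeilCriterion_bump`: `φ̂ ≠ 0` on `E`) the right side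
is constant in `x` (`|e^{(ρ−1/2)x}| = 1` on the line; `−F(û) ≤ (Σ_E m) Σ_E |û(ρ)|²`) and the left side is the
exponential polynomial `Σ_{ρ∈E} m(ρ) conj φ̂(1−ρ̄) û(ρ) e^{(1/2−ρ)x}`; Stub C2 gives `a₀ = L + R` beyond which
`û` vanishes on `E`, whence `F(û) = 0`, `P(gₙ) → 0`, `û = 0` at every non-trivial zero, `û ≡ 0` (Stub C3,
exponential type from `stub_calibration_END_of_RH_norm_weilMellin_le`) and `u = 0` a.e.
(`stub_calibration_END_of_RH_ae_eq_zero_of_weilMellin_eq_zero`) — contradiction.  With the composition below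
this makes `END ⟺ CofiniteCriticalLine` (modulo Anderson's theorem and the import repair). [folklore] -/
theorem stub_calibration_END_of_cofinite : Anderson1983_levinson_simple →
    Summit.RiemannHypothesis.RiemannHypothesis.Theses.RuelleBand.CofiniteCriticalLine →
    ∃ a₀ : ℝ, ∀ a : ℝ, a₀ ≤ a →
      ¬ ∃ (u : ℝ → ℂ) (g : ℕ → ℝ → ℂ), MemLp u 2 volume ∧ ¬ (u =ᵐ[volume] 0) ∧
          (∀ n, IsWeilTest (g n) ∧ tsupport (g n) ⊆ Set.Icc (-a) a) ∧
          Tendsto (fun n => ∫ t, ‖g n t - u t‖ ^ 2) atTop (𝓝 0) ∧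
          Tendsto (fun q : ℕ × ℕ => (weilQuadratic (g q.1 - g q.2)).re) atTop (𝓝 0) ∧
          ∀ h : ℝ → ℂ, IsWeilTest h → tsupport h ⊆ Set.Icc (-a) a →
            Tendsto (fun n => weilFunctional (weilConv (g n) (weilReflect h))) atTop (𝓝 0) :=
  Summit.RiemannHypothesis.RiemannHypothesis.Theorems.RuelleBandCofiniteCriticalLine.stub_calibration_END_of_cofinite

/-- **Calibration from below, UNCONDITIONAL form — LANDED** (lead c2) as `Summit.RiemannHypothesis.RiemannHypothesis.Theorems.RuelleBandCofiniteCriticalLine.stub_calibration_END_of_cofinite_unconditional`: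
`crux ⟹ END` with no named-fact hypothesis (Selberg's distinct-zero count, Stub C4, instead of Anderson's). [folklore] -/
theorem stub_calibration_END_of_cofinite_unconditional_holds :
    Summit.RiemannHypothesis.RiemannHypothesis.Theses.RuelleBand.CofiniteCriticalLine →
    ∃ a₀ : ℝ, ∀ a : ℝ, a₀ ≤ a →
      ¬ ∃ (u : ℝ → ℂ) (g : ℕ → ℝ → ℂ), MemLp u 2 volume ∧ ¬ (u =ᵐ[volume] 0) ∧
          (∀ n, IsWeilTest (g n) ∧ tsupport (g n) ⊆ Set.Icc (-a) a) ∧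
          Tendsto (fun n => ∫ t, ‖g n t - u t‖ ^ 2) atTop (𝓝 0) ∧
          Tendsto (fun q : ℕ × ℕ => (weilQuadratic (g q.1 - g q.2)).re) atTop (𝓝 0) ∧
          ∀ h : ℝ → ℂ, IsWeilTest h → tsupport h ⊆ Set.Icc (-a) a →
            Tendsto (fun n => weilFunctional (weilConv (g n) (weilReflect h))) atTop (𝓝 0) :=
  Summit.RiemannHypothesis.RiemannHypothesis.Theorems.RuelleBandCofiniteCriticalLine.stub_calibration_END_of_cofinite_unconditional

/-- **Stub 2 — continuity of every eigenvalue branch — LANDED but NOT IMPORTABLE HERE** (p84125 as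
`Summit.RiemannHypothesis.RiemannHypothesis.Theorems.RuelleBandCofiniteCriticalLine.stub_branchesContinuous`;
blocked by the tree defect described in the module docstring: duplicate `WeilWindowSimpleEven`). Original text: (triage r1-3 sharpening (2): file
`WindowBranchesContinuous` as its own stub).  For every `k`, the `k`-th Courant–Fischer level of the
window form (inf over linearly independent `(k+1)`-tuples of window test functions of the max of
`Re Q` on their unit `L²`-sphere) is continuous in the window `a ∈ (0, ∞)`.  `k = 0` is Suzuki 2026
Thm 1.3 (`Suzuki2026_thm_1_3_holds`, PROVED: `ContinuousOn weilGroundEnergy (Ioi 0)`; `level a 0 =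
weilGroundEnergy a`); general `k` by the same dilation argument `g ↦ g(λ·)` applied to
finite-dimensional subspaces plus monotonicity in `a`. -/
theorem stub_branchesContinuous :
    ∀ k : ℕ, ContinuousOn (fun a : ℝ =>
      sInf {x : ℝ | ∃ g : Fin (k + 1) → ℝ → ℂ,
        (∀ i, IsWeilTest (g i) ∧ tsupport (g i) ⊆ Set.Icc (-a) a) ∧ LinearIndependent ℂ g ∧
        x = sSup {y : ℝ | ∃ c : Fin (k + 1) → ℂ,
          ∫ t, ‖∑ i, c i * g i t‖ ^ 2 = (1 : ℝ) ∧
          y = (weilQuadratic (fun t => ∑ i, c i * g i t)).re}}) (Set.Ioi 0) := by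
  sorry

/-- **Stub 3a — a zero level between two windows of different index — LANDED** (p95831, helper Aux p95769) as
`Summit.RiemannHypothesis.RiemannHypothesis.Theorems.RuelleBandCofiniteCriticalLine.stub_zeroLevelWindow`
(dictionary `WindowIndexLE a N ↔ 0 ≤ level a N` for `a > 0` via the compact coefficient ellipsoid, then the
intermediate value theorem on `[a₁, a₂]`); re-exported by name. [folklore] -/
theorem stub_zeroLevelWindow_holds :
    (∀ k : ℕ, ContinuousOn (fun a : ℝ =>
        sInf {x : ℝ | ∃ g : Fin (k + 1) → ℝ → ℂ,
          (∀ i, IsWeilTest (g i) ∧ tsupport (g i) ⊆ Set.Icc (-a) a) ∧ LinearIndependent ℂ g ∧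
          x = sSup {y : ℝ | ∃ c : Fin (k + 1) → ℂ,
            ∫ t, ‖∑ i, c i * g i t‖ ^ 2 = (1 : ℝ) ∧
            y = (weilQuadratic (fun t => ∑ i, c i * g i t)).re}}) (Set.Ioi 0)) →
    ∀ (N : ℕ) (a₁ a₂ : ℝ), 0 < a₁ → a₁ ≤ a₂ →
      (∀ g : Fin (N + 1) → ℝ → ℂ, (∀ i, IsWeilTest (g i)) →
          (∀ i, tsupport (g i) ⊆ Set.Icc (-a₁) a₁) →
          ∃ c : Fin (N + 1) → ℂ, c ≠ 0 ∧ 0 ≤ (weilQuadratic (fun t => ∑ i, c i * g i t)).re) →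
      (¬ ∀ g : Fin (N + 1) → ℝ → ℂ, (∀ i, IsWeilTest (g i)) →
          (∀ i, tsupport (g i) ⊆ Set.Icc (-a₂) a₂) →
          ∃ c : Fin (N + 1) → ℂ, c ≠ 0 ∧ 0 ≤ (weilQuadratic (fun t => ∑ i, c i * g i t)).re) →
      ∃ a ∈ Set.Icc a₁ a₂,
        sInf {x : ℝ | ∃ g : Fin (N + 1) → ℝ → ℂ,
          (∀ i, IsWeilTest (g i) ∧ tsupport (g i) ⊆ Set.Icc (-a) a) ∧ LinearIndependent ℂ g ∧
          x = sSup {y : ℝ | ∃ c : Fin (N + 1) → ℂ,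
            ∫ t, ‖∑ i, c i * g i t‖ ^ 2 = (1 : ℝ) ∧
            y = (weilQuadratic (fun t => ∑ i, c i * g i t)).re}} = 0 :=
  Summit.RiemannHypothesis.RiemannHypothesis.Theorems.RuelleBandCofiniteCriticalLine.stub_zeroLevelWindow

/-- **Stub 3b — a zero min–max level is a null vector — LANDED** (p95592, helpers Aux…Aux5) as
`Summit.RiemannHypothesis.RiemannHypothesis.Theorems.RuelleBandCofiniteCriticalLine.stub_zeroLevelNullVector`
(spectral theorem for the compact Gram operator of the form-core completion — `exists_hilbertBasis_form_hasSum`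
machinery — Courant–Fischer over the dense core, CCM Thm 3.6 for compactness; no closability needed); re-exported by name. [folklore] -/
theorem stub_zeroLevelNullVector_holds :
    ∀ (N : ℕ) (a : ℝ), 0 < a →
      sInf {x : ℝ | ∃ g : Fin (N + 1) → ℝ → ℂ,
          (∀ i, IsWeilTest (g i) ∧ tsupport (g i) ⊆ Set.Icc (-a) a) ∧ LinearIndependent ℂ g ∧
          x = sSup {y : ℝ | ∃ c : Fin (N + 1) → ℂ,
            ∫ t, ‖∑ i, c i * g i t‖ ^ 2 = (1 : ℝ) ∧
            y = (weilQuadratic (fun t => ∑ i, c i * g i t)).re}} = 0 →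
      ∃ (u : ℝ → ℂ) (g : ℕ → ℝ → ℂ), MemLp u 2 volume ∧ ¬ (u =ᵐ[volume] 0) ∧
          (∀ n, IsWeilTest (g n) ∧ tsupport (g n) ⊆ Set.Icc (-a) a) ∧
          Tendsto (fun n => ∫ t, ‖g n t - u t‖ ^ 2) atTop (𝓝 0) ∧
          Tendsto (fun q : ℕ × ℕ => (weilQuadratic (g q.1 - g q.2)).re) atTop (𝓝 0) ∧
          ∀ h : ℝ → ℂ, IsWeilTest h → tsupport h ⊆ Set.Icc (-a) a →
            Tendsto (fun n => weilFunctional (weilConv (g n) (weilReflect h))) atTop (𝓝 0) :=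
  Summit.RiemannHypothesis.RiemannHypothesis.Theorems.RuelleBandCofiniteCriticalLine.stub_zeroLevelNullVector

/-- **The staircase steps only at conjugate windows** (crossing lemma; Morse–Kneser shape; the former
registered `stub_conjugateWindow`, now PROVED from Stubs 3a + 3b).  Given branch continuity (Stub 2):
if the index bound `≤ N` holds on the window `a₁ > 0` but fails on `a₂ ≥ a₁`, then some window
`a* ∈ [a₁, a₂]` carries a non-zero null vector of the closed form. [folklore] -/
theorem conjugateWindow_of_stubs :
    (∀ k : ℕ, ContinuousOn (fun a : ℝ =>
        sInf {x : ℝ | ∃ g : Fin (k + 1) → ℝ → ℂ,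
          (∀ i, IsWeilTest (g i) ∧ tsupport (g i) ⊆ Set.Icc (-a) a) ∧ LinearIndependent ℂ g ∧
          x = sSup {y : ℝ | ∃ c : Fin (k + 1) → ℂ,
            ∫ t, ‖∑ i, c i * g i t‖ ^ 2 = (1 : ℝ) ∧
            y = (weilQuadratic (fun t => ∑ i, c i * g i t)).re}}) (Set.Ioi 0)) →
    ∀ (N : ℕ) (a₁ a₂ : ℝ), 0 < a₁ → a₁ ≤ a₂ →
      (∀ g : Fin (N + 1) → ℝ → ℂ, (∀ i, IsWeilTest (g i)) →
          (∀ i, tsupport (g i) ⊆ Set.Icc (-a₁) a₁) →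
          ∃ c : Fin (N + 1) → ℂ, c ≠ 0 ∧ 0 ≤ (weilQuadratic (fun t => ∑ i, c i * g i t)).re) →
      (¬ ∀ g : Fin (N + 1) → ℝ → ℂ, (∀ i, IsWeilTest (g i)) →
          (∀ i, tsupport (g i) ⊆ Set.Icc (-a₂) a₂) →
          ∃ c : Fin (N + 1) → ℂ, c ≠ 0 ∧ 0 ≤ (weilQuadratic (fun t => ∑ i, c i * g i t)).re) →
      ∃ a ∈ Set.Icc a₁ a₂,
        ∃ (u : ℝ → ℂ) (g : ℕ → ℝ → ℂ), MemLp u 2 volume ∧ ¬ (u =ᵐ[volume] 0) ∧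
          (∀ n, IsWeilTest (g n) ∧ tsupport (g n) ⊆ Set.Icc (-a) a) ∧
          Tendsto (fun n => ∫ t, ‖g n t - u t‖ ^ 2) atTop (𝓝 0) ∧
          Tendsto (fun q : ℕ × ℕ => (weilQuadratic (g q.1 - g q.2)).re) atTop (𝓝 0) ∧
          ∀ h : ℝ → ℂ, IsWeilTest h → tsupport h ⊆ Set.Icc (-a) a →
            Tendsto (fun n => weilFunctional (weilConv (g n) (weilReflect h))) atTop (𝓝 0) := by
  intro hcont N a₁ a₂ ha₁ h₁₂ hle hnot
  obtain ⟨a, ha, hlev⟩ := stub_zeroLevelWindow_holds hcont N a₁ a₂ ha₁ h₁₂ hle hnot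
  exact ⟨a, ha, stub_zeroLevelNullVector_holds N a (lt_of_lt_of_le ha₁ ha.1) hlev⟩

/-- **Stub 4 — every window has finite index — LANDED** (p78224) as
`Summit.RiemannHypothesis.RiemannHypothesis.Theorems.RuelleBandCofiniteCriticalLine.stub_windowIndexFinite`
(greedy `1/2`-separated normalised sequence + `ConnesConsaniMoscovici2025_thm_3_6_holds`); re-exported here by name. [folklore] -/
theorem stub_windowIndexFinite_holds :
    ∀ a : ℝ, ∃ N : ℕ, ∀ g : Fin (N + 1) → ℝ → ℂ, (∀ i, IsWeilTest (g i)) →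
        (∀ i, tsupport (g i) ⊆ Set.Icc (-a) a) →
        ∃ c : Fin (N + 1) → ℂ, c ≠ 0 ∧ 0 ≤ (weilQuadratic (fun t => ∑ i, c i * g i t)).re :=
  Summit.RiemannHypothesis.RiemannHypothesis.Theorems.RuelleBandCofiniteCriticalLine.stub_windowIndexFinite

/-- **Stub 5′ — KREĬN's DEFINITIZATION THEOREM — CLOSED** (the named Literature fact
`Literature.Analysis.OperatorTheory.KreinDefinitization`, relocated p83087 into
`Literature/Analysis/OperatorTheory/KreinLangerDefinitization.lean`; M. G. Kreĭn, Dokl. 125 (1959) 31–34; J. Stewart 1972,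
Thm 3.1 + 2.4): a smooth Hermitian function on `ℝ` with at most `κ` negative squares is definitized by `P(−iD) P♯(−iD)` for some
non-zero polynomial `P` of degree `≤ κ`.  PROVED in the tree as `Literature.Analysis.OperatorTheory.KreinDefinitization_holds`
(`KreinLangerDefinitizationProofs.lean`, elementary: finite-dimensional compressions + compactness, no Pontryagin-space
completion); discharged here by name. -/
theorem stub_kreinDefinitization : Literature.Analysis.OperatorTheory.KreinDefinitization :=
  Literature.Analysis.OperatorTheory.KreinDefinitization_holds

/-- **Stub 5 — DEFINITIZATION — LANDED CONDITIONALLY** (p84384, helpers Aux p79117, Aux2 p81610) as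
`Summit.RiemannHypothesis.RiemannHypothesis.Theorems.RuelleBandCofiniteCriticalLine.stub_definitize_of_krein : KreinDefinitization → …`
(translation kernels `K_f = WeilConverse.expSum f` are smooth Hermitian with `≤ N` negative squares under a uniform
window index bound; Kreĭn's theorem definitizes them; zero-side dictionary `P_{P(iD)f} = (P·P*)(−i(ρ−½)) P_f`);
here discharged against the stub `stub_kreinDefinitization`. [folklore] -/
theorem stub_definitize :
    (∃ N : ℕ, ∀ a : ℝ, ∀ g : Fin (N + 1) → ℝ → ℂ, (∀ i, IsWeilTest (g i)) →
        (∀ i, tsupport (g i) ⊆ Set.Icc (-a) a) →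
        ∃ c : Fin (N + 1) → ℂ, c ≠ 0 ∧ 0 ≤ (weilQuadratic (fun t => ∑ i, c i * g i t)).re) →
    ∃ D : ℕ, ∀ f : ℝ → ℂ, IsWeilTest f → ∃ p : Polynomial ℂ, p ≠ 0 ∧ p.natDegree ≤ D ∧
      ∀ (n : ℕ) (x : Fin n → ℝ) (c : Fin n → ℂ),
        0 ≤ (weilQuadratic (fun t => ∑ k, c k *
          (∑ j ∈ Finset.range (p.natDegree + 1),
            p.coeff j * (-1 : ℂ) ^ j * iteratedDeriv j f (t - x k)))).re :=
  Summit.RiemannHypothesis.RiemannHypothesis.Theorems.RuelleBandCofiniteCriticalLine.stub_definitize_of_krein stub_kreinDefinitization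

/-- **Stub 6 — THE COFINITE WEIL CRITERION — LANDED** (p82910) as
`Summit.RiemannHypothesis.RiemannHypothesis.Theorems.RuelleBandCofiniteCriticalLine.stub_cofiniteWeilCriterion`
(the converse Weil criterion run inside one translation orbit; `2D + 1` off-line zeros against `≤ 2D` roots); re-exported by name. [folklore] -/
theorem stub_cofiniteWeilCriterion_holds :
    (∃ D : ℕ, ∀ f : ℝ → ℂ, IsWeilTest f → ∃ p : Polynomial ℂ, p ≠ 0 ∧ p.natDegree ≤ D ∧
        ∀ (n : ℕ) (x : Fin n → ℝ) (c : Fin n → ℂ),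
          0 ≤ (weilQuadratic (fun t => ∑ k, c k *
            (∑ j ∈ Finset.range (p.natDegree + 1),
              p.coeff j * (-1 : ℂ) ^ j * iteratedDeriv j f (t - x k)))).re) →
    {s : ℂ | riemannZeta s = 0 ∧ 0 < s.re ∧ s.re < 1 ∧ s.re ≠ 1 / 2}.Finite :=
  Summit.RiemannHypothesis.RiemannHypothesis.Theorems.RuelleBandCofiniteCriticalLine.stub_cofiniteWeilCriterion

/-! ### Restriction: the index bound is antitone in the window -/

/-- Restriction: an index bound on a window passes to every smaller window (used by the
composition for the windows `a ≤ a₁`). [folklore] -/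
theorem windowIndexLE_anti {a b : ℝ} {N : ℕ} (hab : a ≤ b)
    (h : ∀ g : Fin (N + 1) → ℝ → ℂ, (∀ i, IsWeilTest (g i)) →
        (∀ i, tsupport (g i) ⊆ Set.Icc (-b) b) →
        ∃ c : Fin (N + 1) → ℂ, c ≠ 0 ∧ 0 ≤ (weilQuadratic (fun t => ∑ i, c i * g i t)).re) :
    ∀ g : Fin (N + 1) → ℝ → ℂ, (∀ i, IsWeilTest (g i)) →
      (∀ i, tsupport (g i) ⊆ Set.Icc (-a) a) →
      ∃ c : Fin (N + 1) → ℂ, c ≠ 0 ∧ 0 ≤ (weilQuadratic (fun t => ∑ i, c i * g i t)).re :=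
  fun g hg hsupp => h g hg fun i => (hsupp i).trans (Set.Icc_subset_Icc (neg_le_neg hab) hab)

/-! ### The composition (kernel-checked; concludes the crux BY NAME; uses the stubs by name) -/

/-- **`CofiniteCriticalLine` from the six stubs.**  `a₁ := max a₀ 1 > 0` (`a₀` from Stub 1);
Stub 4 bounds the index on the window `a₁` by some `N`; smaller windows inherit the bound by
restriction (`windowIndexLE_anti`); a larger window violating it would, by Stub 3 fed with Stub 2,
produce a conjugate window in `[a₁, a] ⊆ [a₀, ∞)`, which Stub 1 forbids; so the window index is
uniformly `≤ N`, Stub 5 definitizes, and Stub 6 (the cofinite Weil criterion) gives the finiteness of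
the off-line zero set, which is the crux `RuelleBand.CofiniteCriticalLine` verbatim. -/
theorem CofiniteCriticalLine_of :
    Summit.RiemannHypothesis.RiemannHypothesis.Theses.RuelleBand.CofiniteCriticalLine := by
  show {s : ℂ | riemannZeta s = 0 ∧ 0 < s.re ∧ s.re < 1 ∧ s.re ≠ 1 / 2}.Finite
  refine stub_cofiniteWeilCriterion_holds (stub_definitize ?_)
  obtain ⟨a₀, ha₀⟩ := stub_eventuallyNondegenerate
  obtain ⟨N, hN⟩ := stub_windowIndexFinite_holds (max a₀ 1)
  refine ⟨N, fun a => ?_⟩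
  by_cases ha : a ≤ max a₀ 1
  · exact windowIndexLE_anti ha hN
  · intro g hg hsupp
    by_contra hneg
    have hfail : ¬ (∀ g : Fin (N + 1) → ℝ → ℂ, (∀ i, IsWeilTest (g i)) →
          (∀ i, tsupport (g i) ⊆ Set.Icc (-a) a) →
          ∃ c : Fin (N + 1) → ℂ, c ≠ 0 ∧ 0 ≤ (weilQuadratic (fun t => ∑ i, c i * g i t)).re) :=
      fun hall => hneg (hall g hg hsupp)
    obtain ⟨b, hb, hnull⟩ :=
      conjugateWindow_of_stubs stub_branchesContinuous N (max a₀ 1) a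
        (lt_of_lt_of_le one_pos (le_max_right _ _)) (not_le.mp ha).le hN hfail
    exact ha₀ b ((le_max_left _ _).trans hb.1) hnull

/-! ### END ⟺ crux (lead c2): the bet is exactly the crux -/

/-- **`CofiniteCriticalLine` from END as a HYPOTHESIS** (the composition `CofiniteCriticalLine_of` with the bet replaced by a
hypothesis; uses Stub 2 `stub_branchesContinuous`, whose proof is in the tree, p84125). [folklore] -/
theorem cofinite_of_END
    (hEND : ∃ a₀ : ℝ, ∀ a : ℝ, a₀ ≤ a →
      ¬ ∃ (u : ℝ → ℂ) (g : ℕ → ℝ → ℂ), MemLp u 2 volume ∧ ¬ (u =ᵐ[volume] 0) ∧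
          (∀ n, IsWeilTest (g n) ∧ tsupport (g n) ⊆ Set.Icc (-a) a) ∧
          Tendsto (fun n => ∫ t, ‖g n t - u t‖ ^ 2) atTop (𝓝 0) ∧
          Tendsto (fun q : ℕ × ℕ => (weilQuadratic (g q.1 - g q.2)).re) atTop (𝓝 0) ∧
          ∀ h : ℝ → ℂ, IsWeilTest h → tsupport h ⊆ Set.Icc (-a) a →
            Tendsto (fun n => weilFunctional (weilConv (g n) (weilReflect h))) atTop (𝓝 0)) :
    Summit.RiemannHypothesis.RiemannHypothesis.Theses.RuelleBand.CofiniteCriticalLine := by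
  show {s : ℂ | riemannZeta s = 0 ∧ 0 < s.re ∧ s.re < 1 ∧ s.re ≠ 1 / 2}.Finite
  refine stub_cofiniteWeilCriterion_holds (stub_definitize ?_)
  obtain ⟨a₀, ha₀⟩ := hEND
  obtain ⟨N, hN⟩ := stub_windowIndexFinite_holds (max a₀ 1)
  refine ⟨N, fun a => ?_⟩
  by_cases ha : a ≤ max a₀ 1
  · exact windowIndexLE_anti ha hN
  · intro g hg hsupp
    by_contra hneg
    have hfail : ¬ (∀ g : Fin (N + 1) → ℝ → ℂ, (∀ i, IsWeilTest (g i)) →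
          (∀ i, tsupport (g i) ⊆ Set.Icc (-a) a) →
          ∃ c : Fin (N + 1) → ℂ, c ≠ 0 ∧ 0 ≤ (weilQuadratic (fun t => ∑ i, c i * g i t)).re) :=
      fun hall => hneg (hall g hg hsupp)
    obtain ⟨b, hb, hnull⟩ :=
      conjugateWindow_of_stubs stub_branchesContinuous N (max a₀ 1) a
        (lt_of_lt_of_le one_pos (le_max_right _ _)) (not_le.mp ha).le hN hfail
    exact ha₀ b ((le_max_left _ _).trans hb.1) hnull

/-- **END ⟺ `CofiniteCriticalLine` (lead c2)**: the bet `stub_eventuallyNondegenerate` is EQUIVALENT to the crux — `cofinite_of_END`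
(the line's composition; only `stub_branchesContinuous` is a `sorry` here, proved in the tree p84125) and the LANDED unconditional
calibration `NS.stub_calibration_END_of_cofinite_unconditional`.  One-file version with branch continuity as an explicit hypothesis:
`NS.END_iff_cofiniteCriticalLine` (`Theorems/RuelleBandCofiniteCriticalLineENDIff.lean`).  The line is therefore an exact
operator-side REFORMULATION of rung #5, with no stub weaker than the crux. [folklore] -/
theorem END_iff_cofinite :
    (∃ a₀ : ℝ, ∀ a : ℝ, a₀ ≤ a →
      ¬ ∃ (u : ℝ → ℂ) (g : ℕ → ℝ → ℂ), MemLp u 2 volume ∧ ¬ (u =ᵐ[volume] 0) ∧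
          (∀ n, IsWeilTest (g n) ∧ tsupport (g n) ⊆ Set.Icc (-a) a) ∧
          Tendsto (fun n => ∫ t, ‖g n t - u t‖ ^ 2) atTop (𝓝 0) ∧
          Tendsto (fun q : ℕ × ℕ => (weilQuadratic (g q.1 - g q.2)).re) atTop (𝓝 0) ∧
          ∀ h : ℝ → ℂ, IsWeilTest h → tsupport h ⊆ Set.Icc (-a) a →
            Tendsto (fun n => weilFunctional (weilConv (g n) (weilReflect h))) atTop (𝓝 0)) ↔
    Summit.RiemannHypothesis.RiemannHypothesis.Theses.RuelleBand.CofiniteCriticalLine :=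
  ⟨cofinite_of_END, Summit.RiemannHypothesis.RiemannHypothesis.Theorems.RuelleBandCofiniteCriticalLine.stub_calibration_END_of_cofinite_unconditional⟩

end Summit.RiemannHypothesis.RiemannHypothesis.Cruxes.CofiniteCriticalLine.CofiniteWeilIndexStaircase

end
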